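import Literature.Probability.MarkovChains.GreenTreeFormula
import Literature.Probability.MarkovChains.AbsorbingChainFundamentalMatrix
import HarnessLib

/-!
# Forest formulas for an absorbing chain: the fundamental matrix `N = (I − Q)⁻¹`, the absorption
# times `τ = Nξ` and the absorption probabilities `B = NR` as ratios of forest weights
# (Pitman–Tang (1.4)–(1.9) in «the completely absorbing case»; Kemeny–Snell Ch. III)

HONEST FRAMING (as everywhere in this directory): finite state space, no path space — `N`, `τ`, `B` are
the tree's matrices `absorbingFundamentalMatrix Q = (I − Q)⁻¹`, `absorptionTime Q = Nξ`,
`absorptionProb Q R = NR` of `AbsorbingChainFundamentalMatrix` (Kemeny–Snell's first-step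
characterisations, proved there); this file expresses them through spanning forests.

Lane `lit-hodgefound`, seat p23, generation 47, row g47-#4 of the programme «Tree and forest formulas
for finite Markov chains» [PitmanTang2018] (rows #1 `Combinatorics/Enumerative/MatrixForestTheoremInverse`,
#2 `GreenTreeFormula`, #3 `MeanFirstPassageTreeFormula`).

## Sources, verbatim

[PitmanTang2018] (held text `paper:arxiv-1603.09017`), Thm. 1.2 and p. 4: «Let `R` be a subset of the
finite state space `S` of a Markov chain […] `det L(R) = w(R)` (1.4) […] if `det L(R) > 0`, then
`L(R)^{-1} = ( w_{ij}(R ∪ {j}) / w(R) )` (1.5) […] the matrix in (1.5) is the Green function of the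
Markov chain with transition matrix **P** killed when it hits `R`. From this, we derive […]
`E_i Σ_{n=0}^{T_R−1} 1(X_n = j) = L(R)^{-1}_{ij} = w_{ij}(R ∪ {j})/w(R)` (1.7) […]
`E_i T_R = Σ_{j ∈ S∖R} w_{ij}(R ∪ {j}) / w(R)` (1.8) […] `P_i(X_{T_R} = j) = w_{ij}(R)/w(R)` for `i ∈ S`
and `j ∈ R` (1.9).» §3, proof of Thm. 3.1: «the completely absorbing case when there is a set `R` of
absorbing states with `w(R) > 0`, and `F` is a forest whose set of roots is `R` […] in case 2 [the
conclusion reduces] to the harmonic tree formula (1.9).» Lemma 2.1 (4): «`L(R) := (I − P)_{(S∖R)×(S∖R)}`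
is invertible with inverse `L(R)^{-1} = Σ_{n=0}^∞ P^n_{(S∖R)×(S∖R)}`.»
[KemenySnell1976] Ch. III (as quoted in the tree's `AbsorbingChainFundamentalMatrix`): the canonical
form `P = (I O; R Q)`, «the fundamental matrix to be `N = (I − Q)^{-1}`» (Def. 3.2.2, Thm. 3.2.4
`{M_i[n_j]} = N`), «`{M_i[t]} = τ`», `τ = Nξ` (Thm. 3.3.5), «`{b_{ij}} = B = NR`» (Thm. 3.3.7).

## Setting and what is here

`T` the transient states, `A` the absorbing states, `Q : Matrix T T ℝ` and `R : Matrix T A ℝ` the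
blocks of the canonical form — here the chain on `T ⊕ A` with kernel `Matrix.fromBlocks Q R 0 1`
(`inl` = transient, `inr` = absorbing) — with unit row sums `Σ_a R i a + Σ_j Q i j = 1`; the root set is
the set `𝔄 = univ.map inr` of absorbing states, forests and their weights `w(·) = forestWeight`,
`w_{ij}(·) = forestWeightTo` as in row #1.

* §1 `green_first_step` — for ANY kernel with unit row sums and any root set `R`: the candidate
  `x ↦ w_{ax}(R ∪ {x})` solves the first-step system of the Green function killed on `R`,
  `w_{ax}(R ∪ {x}) = 1(a = x)·w(R) + Σ_y p_{ay} w_{yx}(R ∪ {x})` for `a, x ∉ R` (diagonal = Lemma 2.2,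
  off-diagonal = the harmonic identity (2.9); the one-root case is row #2's `isGreenSolution_forestWeightTo`).
* §2 the canonical form: unit row sums (`fromBlocks_rowsum`), **`det (I − Q) = w(𝔄)`**
  (`det_one_sub_transient_eq_forestWeight`, Thm. 1.2 (1.4) for the absorbing chain), hence
  `w(𝔄) ≠ 0` for an absorbing block (`forestWeight_absorbing_ne_zero`, via the tree's
  `KemenySnell_isUnit_one_sub`).
* §3 **`N_{ij} = w_{ij}(𝔄 ∪ {j}) / w(𝔄)`** (`absorbingFundamentalMatrix_eq_forest`, (1.5)/(1.7) = the
  mean number of visits, K–S Thm. 3.2.4), **`τ_i = Σ_j w_{ij}(𝔄 ∪ {j}) / w(𝔄)`**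
  (`absorptionTime_eq_forest`, (1.8) = K–S Thm. 3.3.5), **`b_{ia} = w_{ia}(𝔄) / w(𝔄)`**
  (`absorptionProb_eq_forest`, (1.9) = K–S Thm. 3.3.7), each by the tree's uniqueness-in-first-step
  theorems.

THEOREMS ONLY (no definition, no named fact, no instance).

## References

* [PitmanTang2018] Thm. 1.2 ((1.4)–(1.6)), eqs. (1.7)–(1.9), Lemma 2.1 (4), Lemma 2.2, (2.9), §3 case 2.
* [KemenySnell1976] Ch. III, Def. 3.2.2, Thms. 3.2.1, 3.2.4, 3.3.5, 3.3.7 (tree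
  `AbsorbingChainFundamentalMatrix`).
-/

namespace Literature.Probability.MarkovChains

open Finset Matrix Function Literature.Combinatorics.Enumerative
  Literature.Combinatorics.SimpleGraph.WeightedMatrixForest

/-! ### §1 The Green first-step identity for a general root set -/

section GreenGeneral

variable {X : Type*} [Fintype X] [DecidableEq X] {p : X → X → ℝ} {R : Finset X}

/-- **The first-step identity of the killed Green function, general root set, division-free**: for a
kernel with unit row sums and `a, x ∉ R`,
`w_{ax}(R ∪ {x}) = 1(a = x) · w(R) + Σ_y p_{ay} · w_{yx}(R ∪ {x})` — diagonal: Lemma 2.2; off the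
diagonal: the harmonic identity (2.9) for the root set `R ∪ {x}` and its root `x`.
[cite: PitmanTang2018, eq. (1.7) with Lemma 2.2 and eq. (2.9) (the combinatorial proof of the Green
tree formula announced in §1: «the Green tree formula (1.7) […] can be proved by purely combinatorial
arguments»)] -/
theorem green_first_step (hp : ∀ x, ∑ y, p x y = 1) {a x : X} (ha : a ∉ R) (hx : x ∉ R) :
    forestWeightTo p (insert x R) a x =
      (if a = x then forestWeight p R else 0) + ∑ y, p a y * forestWeightTo p (insert x R) y x := by
  by_cases hax : a = x
  · -- diagonal: Lemma 2.2 (the roots `y ∈ R` contribute nothing)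
    subst hax
    rw [if_pos rfl, forestWeightTo_self, forestWeight_insert_of_rowsum p hx (hp a)]
    congr 1
    refine sum_subset (subset_univ _) fun y _ hy => ?_
    have hyR : y ∈ R := by simpa using hy
    rw [forestWeightTo_of_mem_roots p _ (mem_insert_of_mem hyR),
      if_neg (fun h : a = y => hx (h ▸ hyR)), mul_zero]
  · -- off the diagonal: (2.9)
    have haR : a ∉ insert x R := by simp [hax, ha]
    have hkey := outWeight_mul_forestWeightTo p haR (mem_insert_self x R)
    rw [if_neg hax, zero_add]
    calc forestWeightTo p (insert x R) a x
        = (∑ k, p a k) * forestWeightTo p (insert x R) a x := by rw [hp a, one_mul]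
      _ = p a a * forestWeightTo p (insert x R) a x +
            ∑ k ∈ univ.erase a, p a k * forestWeightTo p (insert x R) k x := by
          rw [← add_sum_erase _ _ (mem_univ a), add_mul]
          exact congrArg _ hkey
      _ = ∑ y, p a y * forestWeightTo p (insert x R) y x :=
          add_sum_erase _ (fun y => p a y * forestWeightTo p (insert x R) y x) (mem_univ a)

/-- **The harmonic first-step identity, division-free**: for a kernel with unit row sums, `i ∉ R` and a
root `r ∈ R`, `w_{ir}(R) = Σ_y p_{iy} · w_{yr}(R)` ((2.9) plus the diagonal term).
[cite: PitmanTang2018, eq. (1.9) and its proof, eq. (2.9)] -/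
theorem harmonic_first_step (hp : ∀ x, ∑ y, p x y = 1) {i r : X} (hi : i ∉ R) (hr : r ∈ R) :
    forestWeightTo p R i r = ∑ y, p i y * forestWeightTo p R y r := by
  have hkey := outWeight_mul_forestWeightTo p hi hr
  calc forestWeightTo p R i r
      = (∑ k, p i k) * forestWeightTo p R i r := by rw [hp i, one_mul]
    _ = p i i * forestWeightTo p R i r + ∑ k ∈ univ.erase i, p i k * forestWeightTo p R k r := by
        rw [← add_sum_erase _ _ (mem_univ i), add_mul]
        exact congrArg _ hkey
    _ = ∑ y, p i y * forestWeightTo p R y r :=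
        add_sum_erase _ (fun y => p i y * forestWeightTo p R y r) (mem_univ i)

end GreenGeneral

/-! ### §2 The canonical form `(Q R; 0 I)` on `T ⊕ A` and `det (I − Q) = w(𝔄)` -/

section Canonical

variable {T A : Type*} [Fintype T] [DecidableEq T] [Fintype A] [DecidableEq A]
  {Q : Matrix T T ℝ} {R : Matrix T A ℝ}

omit [DecidableEq T] in
/-- The canonical form has unit row sums when the rows of `(R Q)` sum to `1` (absorbing rows are unit
vectors). [cite: KemenySnell1976, §3.1 (canonical form `P = (I O; R Q)`)] [cite: PitmanTang2018, §3
(case 2: «a set `R` of absorbing states»)] -/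
theorem fromBlocks_rowsum (hrow : ∀ i, ∑ a, R i a + ∑ j, Q i j = 1) (x : T ⊕ A) :
    ∑ y, Matrix.fromBlocks Q R 0 (1 : Matrix A A ℝ) x y = 1 := by
  rw [Fintype.sum_sum_type]
  cases x with
  | inl i =>
    simp only [fromBlocks_apply₁₁, fromBlocks_apply₁₂]
    rw [add_comm]
    exact hrow i
  | inr a =>
    simp only [fromBlocks_apply₂₁, fromBlocks_apply₂₂, Matrix.zero_apply, sum_const_zero, zero_add]
    rw [Finset.sum_eq_single a (fun b _ hb => Matrix.one_apply_ne' hb) (fun h => absurd (mem_univ a) h),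
      Matrix.one_apply_eq]

omit [Fintype T] [DecidableEq T] [DecidableEq A] in
/-- Transient states are not roots. [cite: KemenySnell1976, §3.1 (transient vs. absorbing states)] -/
theorem inl_not_mem_map_inr (i : T) :
    (Sum.inl i : T ⊕ A) ∉ (univ : Finset A).map Function.Embedding.inr := by
  simp [Finset.mem_map]

omit [Fintype T] [DecidableEq T] [DecidableEq A] in
/-- Absorbing states are roots. [cite: KemenySnell1976, §3.1] -/
theorem inr_mem_map_inr (a : A) :
    (Sum.inr a : T ⊕ A) ∈ (univ : Finset A).map Function.Embedding.inr :=
  Finset.mem_map_of_mem _ (mem_univ a)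

/-- **`det (I − Q) = w(𝔄)`** — Theorem 1.2 (1.4) for the absorbing chain: the determinant of `I − Q`
(`Q` the transient block) is the total weight of the forests of the canonical chain rooted at the set
`𝔄` of absorbing states. [cite: PitmanTang2018, Thm. 1.2 eq. (1.4) («`L(R) := (I − P)_{(S∖R)×(S∖R)}`»,
Lemma 2.1 (4))] [cite: KemenySnell1976, §3.2 Thm. 3.2.1 («`I − Q` has an inverse»)] -/
theorem det_one_sub_transient_eq_forestWeight (hrow : ∀ i, ∑ a, R i a + ∑ j, Q i j = 1) :
    ((1 : Matrix T T ℝ) - Q).det =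
      forestWeight (fun x y => Matrix.fromBlocks Q R 0 (1 : Matrix A A ℝ) x y)
        ((univ : Finset A).map Function.Embedding.inr) := by
  set 𝔄 : Finset (T ⊕ A) := (univ : Finset A).map Function.Embedding.inr with h𝔄
  set p : (T ⊕ A) → (T ⊕ A) → ℝ := fun x y => Matrix.fromBlocks Q R 0 (1 : Matrix A A ℝ) x y with hp
  -- the transient states are the non-roots: `T ≃ 𝔄ᶜ`
  have hmem : ∀ i : T, (Sum.inl i : T ⊕ A) ∈ 𝔄ᶜ := fun i => mem_compl.2 (inl_not_mem_map_inr i)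
  let e : T ≃ ↥(𝔄ᶜ) := Equiv.ofBijective (fun i => ⟨Sum.inl i, hmem i⟩) (by
    constructor
    · intro i j hij
      exact Sum.inl_injective (congrArg Subtype.val hij)
    · rintro ⟨x, hx⟩
      cases x with
      | inl i => exact ⟨i, rfl⟩
      | inr a => exact absurd (inr_mem_map_inr (T := T) a) (mem_compl.1 hx))
  have hsub : ((wLaplacian p).submatrix (Subtype.val : ↥(𝔄ᶜ) → T ⊕ A) Subtype.val).submatrix e e =
      (1 : Matrix T T ℝ) - Q := by
    ext i j
    simp only [submatrix_apply]
    show wLaplacian p (Sum.inl i) (Sum.inl j) = ((1 : Matrix T T ℝ) - Q) i j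
    rw [wLaplacian_eq_one_sub (P := Matrix.fromBlocks Q R 0 (1 : Matrix A A ℝ)) (fromBlocks_rowsum hrow)]
    rw [Matrix.sub_apply, Matrix.sub_apply, fromBlocks_apply₁₁]
    by_cases hij : i = j
    · subst hij
      rw [Matrix.one_apply_eq, Matrix.one_apply_eq]
    · rw [Matrix.one_apply_ne hij, Matrix.one_apply_ne fun h => hij (Sum.inl_injective h)]
  rw [← det_wLaplacian_submatrix_eq_forestWeight, ← hsub, Matrix.det_submatrix_equiv_self]

/-- For an absorbing transient block the forest weight `w(𝔄)` is non-zero (`I − Q` is invertible).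
[cite: KemenySnell1976, §3.2 Thm. 3.2.1] [cite: PitmanTang2018, Lemma 2.1 ((4) ⟺ (5) ⟺ (1))] -/
theorem forestWeight_absorbing_ne_zero (h : IsAbsorbingBlock Q)
    (hrow : ∀ i, ∑ a, R i a + ∑ j, Q i j = 1) :
    forestWeight (fun x y => Matrix.fromBlocks Q R 0 (1 : Matrix A A ℝ) x y)
        ((univ : Finset A).map Function.Embedding.inr) ≠ 0 := by
  rw [← det_one_sub_transient_eq_forestWeight hrow]
  have hu := KemenySnell_isUnit_one_sub h
  rw [Matrix.isUnit_iff_isUnit_det, isUnit_iff_ne_zero] at hu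
  exact hu

end Canonical

/-! ### §3 `N`, `τ` and `B` as forest ratios -/

section Forest

variable {T A : Type*} [Fintype T] [DecidableEq T] [Fintype A] [DecidableEq A]
  {Q : Matrix T T ℝ} {R : Matrix T A ℝ}

/-- **The fundamental matrix as a forest ratio** (the Green tree formula (1.7) in the completely
absorbing case): `N_{ij} = w_{ij}(𝔄 ∪ {j}) / w(𝔄)` — the weight of the forests of the canonical chain
rooted at the absorbing states and `j`, in which `i` lies in the tree of `j`, over the weight of the
forests rooted at the absorbing states. [cite: PitmanTang2018, Thm. 1.2 eq. (1.5) and eq. (1.7) («the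
matrix in (1.5) is the Green function of the Markov chain […] killed when it hits `R`»)]
[cite: KemenySnell1976, §3.2 Def. 3.2.2, Thm. 3.2.4 (`{M_i[n_j]} = N`)] -/
theorem absorbingFundamentalMatrix_eq_forest (h : IsAbsorbingBlock Q)
    (hrow : ∀ i, ∑ a, R i a + ∑ j, Q i j = 1) (i j : T) :
    absorbingFundamentalMatrix Q i j =
      forestWeightTo (fun x y => Matrix.fromBlocks Q R 0 (1 : Matrix A A ℝ) x y)
          (insert (Sum.inl j) ((univ : Finset A).map Function.Embedding.inr)) (Sum.inl i) (Sum.inl j) /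
        forestWeight (fun x y => Matrix.fromBlocks Q R 0 (1 : Matrix A A ℝ) x y)
          ((univ : Finset A).map Function.Embedding.inr) := by
  set 𝔄 : Finset (T ⊕ A) := (univ : Finset A).map Function.Embedding.inr with h𝔄
  set p : (T ⊕ A) → (T ⊕ A) → ℝ := fun x y => Matrix.fromBlocks Q R 0 (1 : Matrix A A ℝ) x y with hp
  have hw : forestWeight p 𝔄 ≠ 0 := forestWeight_absorbing_ne_zero h hrow
  have hprow : ∀ x, ∑ y, p x y = 1 := fromBlocks_rowsum hrow
  -- the candidate matrix and its first-step equation `M = I + QM`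
  set M : Matrix T T ℝ := fun i j =>
    forestWeightTo p (insert (Sum.inl j) 𝔄) (Sum.inl i) (Sum.inl j) / forestWeight p 𝔄 with hM
  have hfirst : M = 1 + Q * M := by
    ext i j
    rw [Matrix.add_apply, Matrix.mul_apply]
    show forestWeightTo p (insert (Sum.inl j) 𝔄) (Sum.inl i) (Sum.inl j) / forestWeight p 𝔄 =
      (1 : Matrix T T ℝ) i j +
        ∑ k, Q i k * (forestWeightTo p (insert (Sum.inl j) 𝔄) (Sum.inl k) (Sum.inl j) / forestWeight p 𝔄)
    rw [div_eq_iff hw, add_mul, sum_mul]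
    simp_rw [mul_div_assoc', div_mul_cancel₀ _ hw]
    rw [green_first_step hprow (inl_not_mem_map_inr i) (inl_not_mem_map_inr j), Fintype.sum_sum_type]
    -- the absorbing states are roots other than `inl j`: their terms vanish
    have hvan : ∑ b : A, p (Sum.inl i) (Sum.inr b) *
        forestWeightTo p (insert (Sum.inl j) 𝔄) (Sum.inr b) (Sum.inl j) = 0 := by
      refine sum_eq_zero fun b _ => ?_
      rw [forestWeightTo_of_mem_roots p _ (mem_insert_of_mem (inr_mem_map_inr b)),
        if_neg Sum.inl_ne_inr, mul_zero]
    rw [hvan, add_zero]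
    congr 1
    · by_cases hij : i = j
      · subst hij
        rw [if_pos rfl, Matrix.one_apply_eq, one_mul]
      · rw [if_neg fun h' => hij (Sum.inl_injective h'), Matrix.one_apply_ne hij, zero_mul]
  have := eq_absorbingFundamentalMatrix_of_first_step h hfirst
  rw [← this]

/-- **The absorption times as forest ratios** (eq. (1.8) in the completely absorbing case):
`τ_i = Σ_j w_{ij}(𝔄 ∪ {j}) / w(𝔄)`. [cite: PitmanTang2018, eq. (1.8)] [cite: KemenySnell1976, §3.3
Thm. 3.3.5 (`{M_i[t]} = τ = Nξ`)] -/
theorem absorptionTime_eq_forest (h : IsAbsorbingBlock Q) (hrow : ∀ i, ∑ a, R i a + ∑ j, Q i j = 1)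
    (i : T) :
    absorptionTime Q i =
      (∑ j : T, forestWeightTo (fun x y => Matrix.fromBlocks Q R 0 (1 : Matrix A A ℝ) x y)
          (insert (Sum.inl j) ((univ : Finset A).map Function.Embedding.inr)) (Sum.inl i) (Sum.inl j)) /
        forestWeight (fun x y => Matrix.fromBlocks Q R 0 (1 : Matrix A A ℝ) x y)
          ((univ : Finset A).map Function.Embedding.inr) := by
  rw [absorptionTime, Matrix.mulVec, sum_div]
  show ∑ j, absorbingFundamentalMatrix Q i j * 1 = _
  exact sum_congr rfl fun j _ => by rw [mul_one, absorbingFundamentalMatrix_eq_forest h hrow]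

/-- **The absorption probabilities as forest ratios** (the harmonic tree formula (1.9) in the completely
absorbing case): `b_{ia} = w_{ia}(𝔄) / w(𝔄)` — the weight of the forests rooted at the absorbing
states in which `i` lies in the tree of `a`, over their total weight. [cite: PitmanTang2018,
eq. (1.9); §3, proof of Thm. 3.1, case 2] [cite: KemenySnell1976, §3.3 Thm. 3.3.7 (`B = NR`)] -/
theorem absorptionProb_eq_forest (h : IsAbsorbingBlock Q) (hrow : ∀ i, ∑ a, R i a + ∑ j, Q i j = 1)
    (i : T) (a : A) :
    absorptionProb Q R i a =
      forestWeightTo (fun x y => Matrix.fromBlocks Q R 0 (1 : Matrix A A ℝ) x y)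
          ((univ : Finset A).map Function.Embedding.inr) (Sum.inl i) (Sum.inr a) /
        forestWeight (fun x y => Matrix.fromBlocks Q R 0 (1 : Matrix A A ℝ) x y)
          ((univ : Finset A).map Function.Embedding.inr) := by
  set 𝔄 : Finset (T ⊕ A) := (univ : Finset A).map Function.Embedding.inr with h𝔄
  set p : (T ⊕ A) → (T ⊕ A) → ℝ := fun x y => Matrix.fromBlocks Q R 0 (1 : Matrix A A ℝ) x y with hp
  have hw : forestWeight p 𝔄 ≠ 0 := forestWeight_absorbing_ne_zero h hrow
  have hprow : ∀ x, ∑ y, p x y = 1 := fromBlocks_rowsum hrow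
  set B : Matrix T A ℝ := fun i a => forestWeightTo p 𝔄 (Sum.inl i) (Sum.inr a) / forestWeight p 𝔄
    with hB
  have hfirst : B = R + Q * B := by
    ext i a
    rw [Matrix.add_apply, Matrix.mul_apply]
    show forestWeightTo p 𝔄 (Sum.inl i) (Sum.inr a) / forestWeight p 𝔄 =
      R i a + ∑ k, Q i k * (forestWeightTo p 𝔄 (Sum.inl k) (Sum.inr a) / forestWeight p 𝔄)
    rw [div_eq_iff hw, add_mul, sum_mul]
    simp_rw [mul_div_assoc', div_mul_cancel₀ _ hw]
    rw [harmonic_first_step hprow (inl_not_mem_map_inr i) (inr_mem_map_inr a), Fintype.sum_sum_type,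
      add_comm]
    congr 1
    · -- among the roots only `inr a` itself leads to `inr a`
      rw [Finset.sum_eq_single a (fun b _ hb => ?_) (fun h' => absurd (mem_univ a) h')]
      · rw [forestWeightTo_self]
        rfl
      · rw [forestWeightTo_of_mem_roots p _ (inr_mem_map_inr b),
          if_neg (fun h' => hb (Sum.inr_injective h').symm), mul_zero]
  have := eq_absorptionProb_of_first_step h hfirst
  rw [← this]

/-- The absorption probabilities of a transient state sum to `1` over the absorbing states — in forest
form, `Σ_a w_{ia}(𝔄) = w(𝔄)` (every vertex lies in exactly one tree). [cite: KemenySnell1976, §3.3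
(remark after Thm. 3.3.7, «`NRξ = ξ`»)] [cite: PitmanTang2018, eq. (1.9)] -/
theorem sum_forestWeightTo_absorbing (i : T) :
    ∑ a : A, forestWeightTo (fun x y => Matrix.fromBlocks Q R 0 (1 : Matrix A A ℝ) x y)
        ((univ : Finset A).map Function.Embedding.inr) (Sum.inl i) (Sum.inr a) =
      forestWeight (fun x y => Matrix.fromBlocks Q R 0 (1 : Matrix A A ℝ) x y)
        ((univ : Finset A).map Function.Embedding.inr) := by
  rw [← sum_forestWeightTo _ ((univ : Finset A).map Function.Embedding.inr) (Sum.inl i), sum_map]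
  rfl

end Forest

end Literature.Probability.MarkovChains
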